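import Literature.AlgebraicGeometry.Smoothening.SmoothSpecialFibreResidue
import Literature.AlgebraicGeometry.Smoothening.SmoothSpecialFibrePoints
import HarnessLib

/-!
# Separability of the residue fields at codimension-one points of the special fibre: abstract
# localisations

Topic: `Literature/AlgebraicGeometry/Smoothening` (Bosch–Lütkebohmert–Raynaud, *Néron Models*,
§2.3, §3.6: test rings "of ramification index `1`"). Transport of `SmoothSpecialFibreResidue` from
`Localization.AtPrime P` to an arbitrary localisation `S` of `A` at `P` (in practice a stalk
`𝒪_{X,y}`), as in `SmoothSpecialFibrePoints`: `R → S` is a local homomorphism and the induced map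
of residue fields is formally smooth (`κ(S)/k` separable). [folklore]; no named facts (D-0026).

## References

* S. Bosch, W. Lütkebohmert, M. Raynaud, *Néron Models*, Springer 1990, §2.3, §3.6.
  [BLRNeronModels1990] (Not held; section numbers only.)
-/

noncomputable section

open IsLocalRing

namespace Literature.AlgebraicGeometry.Smoothening

universe u

variable {R : Type u} [CommRing R] [IsDomain R] [IsDiscreteValuationRing R] {ϖ : R} (hϖ : Irreducible ϖ)
  {A : Type u} [CommRing A] [Algebra R A] [Algebra.Smooth R A]
  (P : Ideal A) [P.IsPrime] (hP : P ∈ (Ideal.span {algebraMap R A ϖ}).minimalPrimes)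
  (S : Type u) [CommRing S] [IsLocalRing S] [Algebra A S] [Algebra R S] [IsScalarTower R A S]
  [IsLocalization.AtPrime S P]

omit [IsDomain R] [IsDiscreteValuationRing R] [Algebra.Smooth R A] [IsLocalRing S] in
/-- `R → S` is `R → A_P ≅ S`. [folklore] -/
theorem algebraMap_eq_comp_algEquiv :
    algebraMap R S = (IsLocalization.algEquiv P.primeCompl (Localization.AtPrime P) S).toRingEquiv.toRingHom.comp
      (algebraMap R (Localization.AtPrime P)) := by
  refine RingHom.ext fun r => ?_
  change algebraMap R S r = IsLocalization.algEquiv P.primeCompl (Localization.AtPrime P) S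
    (algebraMap R (Localization.AtPrime P) r)
  rw [IsScalarTower.algebraMap_apply R A (Localization.AtPrime P), AlgEquiv.commutes,
    ← IsScalarTower.algebraMap_apply]

omit [Algebra.Smooth R A] [IsLocalRing S] in
include hϖ hP in
/-- `R → S` is a local homomorphism for a localisation `S` of `A` at a minimal prime of `ϖA`.
[folklore] -/
theorem isLocalHom_algebraMap_of_isLocalization_atPrime : IsLocalHom (algebraMap R S) := by
  haveI := isLocalHom_algebraMap_localization P hP hϖ.maximalIdeal_eq
  haveI : IsLocalHom (IsLocalization.algEquiv P.primeCompl (Localization.AtPrime P) S).toRingEquiv.toRingHom :=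
    isLocalHom_toRingHom (IsLocalization.algEquiv P.primeCompl (Localization.AtPrime P) S).toRingEquiv
  rw [algebraMap_eq_comp_algEquiv P S]
  infer_instance

include hϖ hP in
/-- **The residue field of `S` is separable over `k`**: the map of residue fields induced by the
local homomorphism `R → S` is formally smooth (`SmoothSpecialFibreResidue`, transported along
`A_P ≅ S`). [folklore] -/
theorem formallySmooth_residueFieldMap_of_isLocalization_atPrime :
    haveI := isLocalHom_algebraMap_of_isLocalization_atPrime hϖ P hP S
    (ResidueField.map (algebraMap R S)).FormallySmooth := by
  haveI hS := isLocalHom_algebraMap_of_isLocalization_atPrime hϖ P hP S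
  haveI hL := isLocalHom_algebraMap_localization P hP hϖ.maximalIdeal_eq
  let e := (IsLocalization.algEquiv P.primeCompl (Localization.AtPrime P) S).toRingEquiv
  haveI he : IsLocalHom e.toRingHom := isLocalHom_toRingHom e
  have h0 := formallySmooth_residueFieldMap hϖ P hP
  have h1 : ((ResidueField.mapEquiv e).toRingHom.comp
      (ResidueField.map (algebraMap R (Localization.AtPrime P)))).FormallySmooth :=
    RingHom.FormallySmooth.respectsIso.left _ (ResidueField.mapEquiv e) h0
  have heq : ResidueField.map (algebraMap R S) = (ResidueField.mapEquiv e).toRingHom.comp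
      (ResidueField.map (algebraMap R (Localization.AtPrime P))) := by
    refine Ideal.Quotient.ringHom_ext (I := maximalIdeal R) (RingHom.ext fun r => ?_)
    change ResidueField.map (algebraMap R S) (residue R r) =
      ResidueField.mapEquiv e (ResidueField.map (algebraMap R (Localization.AtPrime P)) (residue R r))
    rw [ResidueField.map_residue, ResidueField.map_residue, ResidueField.mapEquiv_apply,
      ResidueField.map_residue]
    congr 1
    exact congrFun (congrArg DFunLike.coe (algebraMap_eq_comp_algEquiv P S)) r
  rw [heq]
  exact h1

end Literature.AlgebraicGeometry.Smoothening

end
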